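import Summits.CriticalPhenomena.PercolationContinuityZ3.Theorems.PercNearOneGluingNoHeavyLowerTailSetPortMerge
import HarnessLib

/-!
# `NoHeavyLowerTail` (stmt-CriticalPhenomena-4575) — merging an observer set into its anchor: the weight transport

Support file (prover `prim-hp-6`, hull-port cell; `--supports stmt-CriticalPhenomena-4575`).  No definitions, no named
facts, no sorries.  Continues `…SetPortMerge.lean` (notation there: agreement modulo `U`, `U`-stable events).

* `SetPort.real_eq_update_of_internal` — a pair inside `U` is irrelevant to a `U`-stable event.
* `SetPort.real_eq_orMerge_member` — one OR-merge of the coins `s(u₁,v), s(x,v)` (`x ∈ U ∖ {u₁}`, `v ∉ U`) preserves a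
  `U`-stable event.
* `SetPort.real_eq_of_merged` — **member merge.**  For a `U`-stable event `E` and any weight function `w♯` that agrees with
  `w` off `U`, vanishes on every pair meeting `U` other than the anchor's outside pairs, and gives the anchor the merged coins
  `1 − w♯ s(u₁,v) = ∏_{x ∈ U} (1 − w s(x,v))` (`v ∉ U`):  `μ_w(E) = μ_{w♯}(E)`.  Induction on the number of positive pairs
  at `U ∖ {u₁}`: each is removed by one OR-merge (outside end) or is irrelevant (inside end).
-/

noncomputable section

namespace Summit.CriticalPhenomena.PercolationContinuityZ3.Theorems

open MeasureTheory Set Literature.Probability.LatticeModels Literature.Probability.Percolation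
open scoped Classical BigOperators

variable {n : ℕ}

namespace SetPort

/-! ### Elementary moves preserve the probability of a stable event -/

/-- A pair inside `U` (both ends in `U`) is irrelevant to a `U`-stable event. [folklore] -/
theorem real_eq_update_of_internal (w : Sym2 (Fin n) → unitInterval) (U : Finset (Fin n))
    {E : Set (BondConfig (Fin n))}
    (hE : (∀ ω ω' : BondConfig (Fin n),
      ((∀ e : Sym2 (Fin n), (∀ u ∈ U, u ∉ e) → (e ∈ ω ↔ e ∈ ω')) ∧
        (∀ v : Fin n, v ∉ U → ((∃ x ∈ U, s(x, v) ∈ ω) ↔ (∃ x ∈ U, s(x, v) ∈ ω')))) →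
      (ω ∈ E ↔ ω' ∈ E))) {e : Sym2 (Fin n)} (he : ∀ z ∈ e, z ∈ U)
    (t : unitInterval) :
    (prodBernoulli w).real E = (prodBernoulli (Function.update w e t)).real E := by
  have hdet : DeterminedBy E ({e}ᶜ : Set (Sym2 (Fin n))) := by
    rw [determinedBy_iff]
    intro ω ω' h
    apply hE
    refine ⟨fun f hf => ?_, fun v hv => ?_⟩
    · have hfe : f ≠ e := by
        intro hfe; subst hfe
        obtain ⟨z, hz⟩ : ∃ z, z ∈ f := ⟨_, Sym2.out_fst_mem f⟩
        exact hf z (he z hz) hz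
      have := Set.ext_iff.1 h f
      simp only [mem_inter_iff, mem_compl_iff, mem_singleton_iff, hfe, not_false_eq_true, and_true] at this
      exact this
    · refine exists_congr fun x => and_congr_right fun hx => ?_
      have hne : s(x, v) ≠ e := fun hxe => hv (he v (hxe ▸ Sym2.mem_mk_right x v))
      have := Set.ext_iff.1 h s(x, v)
      simp only [mem_inter_iff, mem_compl_iff, mem_singleton_iff, hne, not_false_eq_true, and_true] at this
      exact this
  refine prodBernoulli_real_eq_of_determinedBy w _ (fun i hi => ?_) hdet (Set.toFinite _).measurableSet
  simp only [mem_compl_iff, mem_singleton_iff] at hi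
  simp [Function.update_of_ne hi]

/-- One OR-merge of the coins `s(u₁,v), s(x,v)` (`u₁ ≠ x` in `U`, `v ∉ U`) preserves a `U`-stable event. [folklore] -/
theorem real_eq_orMerge_member (w : Sym2 (Fin n) → unitInterval) (U : Finset (Fin n)) {E : Set (BondConfig (Fin n))}
    (hE : (∀ ω ω' : BondConfig (Fin n),
      ((∀ e : Sym2 (Fin n), (∀ u ∈ U, u ∉ e) → (e ∈ ω ↔ e ∈ ω')) ∧
        (∀ v : Fin n, v ∉ U → ((∃ x ∈ U, s(x, v) ∈ ω) ↔ (∃ x ∈ U, s(x, v) ∈ ω')))) →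
      (ω ∈ E ↔ ω' ∈ E))) {u₁ x v : Fin n} (hu₁ : u₁ ∈ U) (hx : x ∈ U) (hux : u₁ ≠ x) (hv : v ∉ U)
    (m : unitInterval) (hm : (m : ℝ) = 1 - (1 - (w s(u₁, v) : ℝ)) * (1 - (w s(x, v) : ℝ))) :
    (prodBernoulli w).real E =
      (prodBernoulli (Function.update (Function.update w s(x, v) 0) s(u₁, v) m)).real E := by
  have h12 : s(u₁, v) ≠ s(x, v) := by
    intro h
    have := Sym2.eq_iff.1 h
    rcases this with ⟨h1, -⟩ | ⟨h1, h2⟩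
    · exact hux h1
    · exact hv (h1 ▸ hu₁)
  -- the three configurations of the OR-merge agree modulo `U`
  have hagree : ∀ (ω : BondConfig (Fin n)) (a b : Fin n), a ∈ U → b ∈ U → ∀ (ξ : BondConfig (Fin n)),
      (∀ f, (∀ u ∈ U, u ∉ f) → (f ∈ ξ ↔ f ∈ ω)) → s(a, v) ∈ ξ →
      (∀ v', v' ∉ U → v' ≠ v → ∀ y ∈ U, (s(y, v') ∈ ξ ↔ s(y, v') ∈ ω)) →
      ∀ (ξ' : BondConfig (Fin n)), (∀ f, (∀ u ∈ U, u ∉ f) → (f ∈ ξ' ↔ f ∈ ω)) → s(b, v) ∈ ξ' →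
      (∀ v', v' ∉ U → v' ≠ v → ∀ y ∈ U, (s(y, v') ∈ ξ' ↔ s(y, v') ∈ ω)) →
      ((∀ e : Sym2 (Fin n), (∀ u ∈ U, u ∉ e) → (e ∈ ξ ↔ e ∈ ξ')) ∧
        (∀ v : Fin n, v ∉ U → ((∃ x ∈ U, s(x, v) ∈ ξ) ↔ (∃ x ∈ U, s(x, v) ∈ ξ')))) := by
    intro ω a b ha hb ξ hξ1 hξ2 hξ3 ξ' hξ'1 hξ'2 hξ'3
    refine ⟨fun f hf => (hξ1 f hf).trans (hξ'1 f hf).symm, fun v' hv' => ?_⟩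
    by_cases hvv : v' = v
    · subst hvv
      exact ⟨fun _ => ⟨b, hb, hξ'2⟩, fun _ => ⟨a, ha, hξ2⟩⟩
    · refine exists_congr fun y => and_congr_right fun hy => ?_
      rw [hξ3 v' hv' hvv y hy, hξ'3 v' hv' hvv y hy]
  -- membership facts for the modified configurations
  have hoff_ins_diff : ∀ (ω : BondConfig (Fin n)) (a b : Fin n), a ∈ U → b ∈ U →
      ∀ f, (∀ u ∈ U, u ∉ f) → (f ∈ insert s(a, v) (ω \ {s(b, v)}) ↔ f ∈ ω) := by
    intro ω a b ha hb f hf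
    have hfa : f ≠ s(a, v) := fun h => hf a ha (h ▸ Sym2.mem_mk_left a v)
    have hfb : f ≠ s(b, v) := fun h => hf b hb (h ▸ Sym2.mem_mk_left b v)
    simp [hfa, hfb]
  have hother_ins_diff : ∀ (ω : BondConfig (Fin n)) (a b : Fin n), a ∈ U → b ∈ U →
      ∀ v', v' ∉ U → v' ≠ v → ∀ y ∈ U, (s(y, v') ∈ insert s(a, v) (ω \ {s(b, v)}) ↔ s(y, v') ∈ ω) := by
    intro ω a b ha hb v' hv' hvv y hy
    have hne : ∀ d ∈ U, s(y, v') ≠ s(d, v) := by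
      intro d hd h
      rcases Sym2.eq_iff.1 h with ⟨-, h2⟩ | ⟨-, h2⟩
      · exact hvv h2
      · exact hv' (h2 ▸ hd)
    simp [hne a ha, hne b hb]
  have hswap : ∀ ω : BondConfig (Fin n),
      insert s(x, v) (ω \ {s(u₁, v)}) ∈ E ↔ insert s(u₁, v) (ω \ {s(x, v)}) ∈ E := by
    intro ω
    apply hE
    exact hagree ω x u₁ hx hu₁ _ (hoff_ins_diff ω x u₁ hx hu₁) (Set.mem_insert _ _)
      (hother_ins_diff ω x u₁ hx hu₁) _ (hoff_ins_diff ω u₁ x hu₁ hx) (Set.mem_insert _ _)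
      (hother_ins_diff ω u₁ x hu₁ hx)
  have hboth : ∀ ω : BondConfig (Fin n),
      insert s(u₁, v) (insert s(x, v) ω) ∈ E ↔ insert s(u₁, v) (ω \ {s(x, v)}) ∈ E := by
    intro ω
    apply hE
    refine hagree ω u₁ u₁ hu₁ hu₁ _ ?_ (Set.mem_insert _ _) ?_ _ (hoff_ins_diff ω u₁ x hu₁ hx)
      (Set.mem_insert _ _) (hother_ins_diff ω u₁ x hu₁ hx)
    · intro f hf
      have hfa : f ≠ s(u₁, v) := fun h => hf u₁ hu₁ (h ▸ Sym2.mem_mk_left u₁ v)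
      have hfb : f ≠ s(x, v) := fun h => hf x hx (h ▸ Sym2.mem_mk_left x v)
      simp [hfa, hfb]
    · intro v' hv' hvv y hy
      have hne : ∀ d ∈ U, s(y, v') ≠ s(d, v) := by
        intro d hd h
        rcases Sym2.eq_iff.1 h with ⟨-, h2⟩ | ⟨-, h2⟩
        · exact hvv h2
        · exact hv' (h2 ▸ hd)
      simp [hne u₁ hu₁, hne x hx]
  exact orMerge_real_eq w h12 E hswap hboth m hm


/-! ### The member merge -/

/-- **Member merge.**  Let `u₁ ∈ U` and let `E` be `U`-stable.  Let `w♯` agree with `w` on the pairs off `U`, vanish on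
every pair meeting `U` that is not an outside pair `s(u₁, v)` (`v ∉ U`) of the anchor, and carry the merged coins
`1 − w♯ s(u₁,v) = ∏_{x ∈ U} (1 − w s(x,v))` for `v ∉ U`.  Then `μ_w(E) = μ_{w♯}(E)`. [folklore] -/
theorem real_eq_of_merged (w wm : Sym2 (Fin n) → unitInterval) (U : Finset (Fin n)) {u₁ : Fin n} (hu₁ : u₁ ∈ U)
    {E : Set (BondConfig (Fin n))}
    (hE : (∀ ω ω' : BondConfig (Fin n),
      ((∀ e : Sym2 (Fin n), (∀ u ∈ U, u ∉ e) → (e ∈ ω ↔ e ∈ ω')) ∧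
        (∀ v : Fin n, v ∉ U → ((∃ x ∈ U, s(x, v) ∈ ω) ↔ (∃ x ∈ U, s(x, v) ∈ ω')))) →
      (ω ∈ E ↔ ω' ∈ E)))
    (hoff : ∀ e : Sym2 (Fin n), (∀ u ∈ U, u ∉ e) → wm e = w e)
    (hzero : ∀ e : Sym2 (Fin n), (∃ u ∈ U, u ∈ e) → (¬ ∃ v : Fin n, v ∉ U ∧ e = s(u₁, v)) → wm e = 0)
    (hcoin : ∀ v : Fin n, v ∉ U → (1 - (wm s(u₁, v) : ℝ)) = ∏ x ∈ U, (1 - (w s(x, v) : ℝ))) :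
    (prodBernoulli w).real E = (prodBernoulli wm).real E := by
  -- the positive pairs at the non-anchor members
  set bad : (Sym2 (Fin n) → unitInterval) → Finset (Sym2 (Fin n)) := fun v =>
    (Finset.univ : Finset (Sym2 (Fin n))).filter (fun e => v e ≠ 0 ∧ ∃ u ∈ U, u ≠ u₁ ∧ u ∈ e) with hbad
  suffices H : ∀ (N : ℕ) (v : Sym2 (Fin n) → unitInterval), (bad v).card = N →
      (∀ e : Sym2 (Fin n), (∀ u ∈ U, u ∉ e) → wm e = v e) →
      (∀ y : Fin n, y ∉ U → (1 - (wm s(u₁, y) : ℝ)) = ∏ x ∈ U, (1 - (v s(x, y) : ℝ))) →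
      (prodBernoulli v).real E = (prodBernoulli wm).real E from H _ w rfl hoff hcoin
  intro N
  induction N using Nat.strong_induction_on with
  | _ N ih =>
    intro v hN hoffv hcoinv
    rcases Nat.eq_zero_or_pos N with hN0 | hNpos
    · -- no positive pair at `U ∖ {u₁}`: `v` and `wm` differ only on pairs inside `U`
      have hv0 : ∀ e : Sym2 (Fin n), (∃ u ∈ U, u ≠ u₁ ∧ u ∈ e) → v e = 0 := by
        intro e he
        by_contra hne
        have : e ∈ bad v := by simp only [hbad, Finset.mem_filter, Finset.mem_univ, true_and]; exact ⟨hne, he⟩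
        have hpos := Finset.card_pos.2 ⟨e, this⟩
        rw [hN] at hpos
        omega
      have hdet : DeterminedBy E {e : Sym2 (Fin n) | ∃ z ∈ e, z ∉ U} := by
        rw [determinedBy_iff]
        intro ω ω' h
        apply hE
        refine ⟨fun f hf => ?_, fun y hy => ?_⟩
        · have hfm : f ∈ {e : Sym2 (Fin n) | ∃ z ∈ e, z ∉ U} :=
            ⟨_, Sym2.out_fst_mem f, fun hzU => hf _ hzU (Sym2.out_fst_mem f)⟩
          have := Set.ext_iff.1 h f
          simp only [mem_inter_iff, hfm, and_true] at this
          exact this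
        · refine exists_congr fun x => and_congr_right fun hx => ?_
          have hfm : s(x, y) ∈ {e : Sym2 (Fin n) | ∃ z ∈ e, z ∉ U} := ⟨y, Sym2.mem_mk_right x y, hy⟩
          have := Set.ext_iff.1 h s(x, y)
          simp only [mem_inter_iff, hfm, and_true] at this
          exact this
      refine prodBernoulli_real_eq_of_determinedBy v wm (fun e he => ?_) hdet (Set.toFinite _).measurableSet
      obtain ⟨z, hz, hzU⟩ := he
      by_cases hU : ∃ u ∈ U, u ∈ e
      swap
      · exact (hoffv e fun u hu hue => hU ⟨u, hu, hue⟩).symm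
      · obtain ⟨u, hu, hue⟩ := hU
        by_cases huu : u = u₁
        · -- `e = s(u₁, z)` with `z ∉ U`: the merged coin equals the anchor's coin
          subst huu
          have hez : e = s(u, z) := by
            have hzo : Sym2.Mem.other hue = z ∨ u = z := by
              have h1 : z ∈ s(u, Sym2.Mem.other hue) := by rw [Sym2.other_spec hue]; exact hz
              rcases Sym2.mem_iff.1 h1 with h | h
              · exact Or.inr h.symm
              · exact Or.inl h.symm
            rcases hzo with h | h
            · rw [← h, Sym2.other_spec hue]
            · exact absurd (h ▸ hu) hzU
          rw [hez]
          have key := hcoinv z hzU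
          rw [Finset.prod_eq_single_of_mem u hu (fun x hx hne => by
            rw [hv0 s(x, z) ⟨x, hx, hne, Sym2.mem_mk_left x z⟩]; simp)] at key
          exact Subtype.ext (by linarith)
        · -- a pair at a non-anchor member, not an anchor coin: both weights vanish
          have h1 : v e = 0 := hv0 e ⟨u, hu, huu, hue⟩
          have h2 : wm e = 0 := by
            refine hzero e ⟨u, hu, hue⟩ ?_
            rintro ⟨y, hyU, rfl⟩
            rcases Sym2.mem_iff.1 hue with h | h
            · exact huu h
            · exact hyU (h ▸ hu)
          rw [h1, h2]
    · -- pick a positive pair `e₀` at a non-anchor member `x`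
      obtain ⟨e₀, he₀⟩ := Finset.card_pos.1 (hN ▸ hNpos)
      simp only [hbad, Finset.mem_filter, Finset.mem_univ, true_and] at he₀
      obtain ⟨hve₀, x, hx, hxu, hxe⟩ := he₀
      set y := Sym2.Mem.other hxe with hy
      have he₀xy : e₀ = s(x, y) := (Sym2.other_spec hxe).symm
      by_cases hyU : y ∈ U
      · -- internal pair: irrelevant
        set v₀ := Function.update v e₀ 0 with hv₀
        have hstep : (prodBernoulli v).real E = (prodBernoulli v₀).real E :=
          real_eq_update_of_internal v U hE (e := e₀) (by
            intro z hz; rw [he₀xy] at hz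
            rcases Sym2.mem_iff.1 hz with rfl | rfl
            · exact hx
            · exact hyU) 0
        rw [hstep]
        have hsub : bad v₀ ⊆ bad v := by
          intro e he
          simp only [hbad, Finset.mem_filter, Finset.mem_univ, true_and] at he ⊢
          refine ⟨?_, he.2⟩
          by_cases hee : e = e₀
          · subst hee; simp [hv₀] at he
          · rw [hv₀, Function.update_of_ne hee] at he; exact he.1
        have hmem : e₀ ∈ bad v := by
          simp only [hbad, Finset.mem_filter, Finset.mem_univ, true_and]; exact ⟨hve₀, x, hx, hxu, hxe⟩
        have hnmem : e₀ ∉ bad v₀ := by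
          simp only [hbad, Finset.mem_filter, Finset.mem_univ, true_and, not_and]; intro h; simp [hv₀] at h
        have hlt : (bad v₀).card < N := by
          rw [← hN]; exact Finset.card_lt_card ⟨hsub, fun h => hnmem (h hmem)⟩
        refine ih _ hlt v₀ rfl (fun e he => ?_) (fun z hz => ?_)
        · have hee : e ≠ e₀ := fun h => he x hx (h ▸ hxe)
          rw [hv₀, Function.update_of_ne hee]; exact hoffv e he
        · rw [hcoinv z hz]
          refine Finset.prod_congr rfl fun x' hx' => ?_
          have hee : s(x', z) ≠ e₀ := by
            intro h; rw [he₀xy] at h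
            rcases Sym2.eq_iff.1 h with ⟨-, h2⟩ | ⟨-, h2⟩
            · exact hz (h2 ▸ hyU)
            · exact hz (h2 ▸ hx)
          rw [hv₀, Function.update_of_ne hee]
      · -- outside pair at a non-anchor member: OR-merge it into the anchor's coin
        set m : unitInterval := ⟨1 - (1 - (v s(u₁, y) : ℝ)) * (1 - (v s(x, y) : ℝ)), orWeight_mem _ _⟩ with hm
        set v' := Function.update (Function.update v s(x, y) 0) s(u₁, y) m with hv'
        have hux : u₁ ≠ x := fun h => hxu h.symm
        have hstep : (prodBernoulli v).real E = (prodBernoulli v').real E :=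
          real_eq_orMerge_member v U hE hu₁ hx hux hyU m rfl
        rw [hstep]
        have h12 : s(u₁, y) ≠ s(x, y) := by
          intro h
          rcases Sym2.eq_iff.1 h with ⟨h1, -⟩ | ⟨h1, -⟩
          · exact hux h1
          · exact hyU (h1 ▸ hu₁)
        have hv'1 : v' s(u₁, y) = m := by simp [hv']
        have hv'2 : v' s(x, y) = 0 := by simp [hv', Function.update_of_ne (Ne.symm h12)]
        have hv'3 : ∀ e, e ≠ s(u₁, y) → e ≠ s(x, y) → v' e = v e := by
          intro e h1 h2; simp [hv', Function.update_of_ne h1, Function.update_of_ne h2]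
        have hsub : bad v' ⊆ bad v := by
          intro e he
          simp only [hbad, Finset.mem_filter, Finset.mem_univ, true_and] at he ⊢
          refine ⟨?_, he.2⟩
          have h1 : e ≠ s(u₁, y) := by
            rintro rfl
            obtain ⟨u, hu, huu, hue⟩ := he.2
            rcases Sym2.mem_iff.1 hue with h | h
            · exact huu h
            · exact hyU (h ▸ hu)
          have h2 : e ≠ s(x, y) := by rintro rfl; exact he.1 hv'2
          rw [hv'3 e h1 h2] at he; exact he.1
        have hmem : s(x, y) ∈ bad v := by
          simp only [hbad, Finset.mem_filter, Finset.mem_univ, true_and]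
          exact ⟨he₀xy ▸ hve₀, x, hx, hxu, Sym2.mem_mk_left x y⟩
        have hnmem : s(x, y) ∉ bad v' := by
          simp only [hbad, Finset.mem_filter, Finset.mem_univ, true_and, not_and]; intro h; exact absurd hv'2 h
        have hlt : (bad v').card < N := by
          rw [← hN]; exact Finset.card_lt_card ⟨hsub, fun h => hnmem (h hmem)⟩
        refine ih _ hlt v' rfl (fun e he => ?_) (fun z hz => ?_)
        · have h1 : e ≠ s(u₁, y) := fun h => he u₁ hu₁ (h ▸ Sym2.mem_mk_left u₁ y)
          have h2 : e ≠ s(x, y) := fun h => he x hx (h ▸ Sym2.mem_mk_left x y)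
          rw [hv'3 e h1 h2]; exact hoffv e he
        · rw [hcoinv z hz]
          by_cases hzy : z = y
          · subst hzy
            -- the two modified factors recombine
            have hxU' : x ∈ U.erase u₁ := Finset.mem_erase.2 ⟨hxu, hx⟩
            rw [← Finset.mul_prod_erase U _ hu₁, ← Finset.mul_prod_erase U _ hu₁,
              ← Finset.mul_prod_erase (U.erase u₁) _ hxU', ← Finset.mul_prod_erase (U.erase u₁) _ hxU',
              hv'1, hv'2]
            have hrest : ∏ x' ∈ (U.erase u₁).erase x, (1 - (v' s(x', y) : ℝ)) =
                ∏ x' ∈ (U.erase u₁).erase x, (1 - (v s(x', y) : ℝ)) := by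
              refine Finset.prod_congr rfl fun x' hx' => ?_
              have hx'1 : x' ≠ x := (Finset.mem_erase.1 hx').1
              have hx'2 : x' ≠ u₁ := (Finset.mem_erase.1 (Finset.mem_erase.1 hx').2).1
              have h1 : s(x', y) ≠ s(u₁, y) := by
                intro h; rcases Sym2.eq_iff.1 h with ⟨h', -⟩ | ⟨h', -⟩
                · exact hx'2 h'
                · exact hyU (h' ▸ (Finset.mem_erase.1 (Finset.mem_erase.1 hx').2).2)
              have h2 : s(x', y) ≠ s(x, y) := by
                intro h; rcases Sym2.eq_iff.1 h with ⟨h', -⟩ | ⟨h', -⟩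
                · exact hx'1 h'
                · exact hyU (h' ▸ (Finset.mem_erase.1 (Finset.mem_erase.1 hx').2).2)
              rw [hv'3 _ h1 h2]
            rw [hrest, hm]
            push_cast
            ring
          · refine Finset.prod_congr rfl fun x' hx' => ?_
            have h1 : s(x', z) ≠ s(u₁, y) := by
              intro h; rcases Sym2.eq_iff.1 h with ⟨-, h2⟩ | ⟨-, h2⟩
              · exact hzy h2
              · exact hz (h2 ▸ hu₁)
            have h2 : s(x', z) ≠ s(x, y) := by
              intro h; rcases Sym2.eq_iff.1 h with ⟨-, h2⟩ | ⟨-, h2⟩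
              · exact hzy h2
              · exact hz (h2 ▸ hx)
            rw [hv'3 _ h1 h2]

end SetPort

end Summit.CriticalPhenomena.PercolationContinuityZ3.Theorems

end
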